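import Literature.NumberTheory.Transcendental.ComplexFormsPullback
import Literature.Geometry.Manifold.ModelChange
import Literature.Analysis.Complex.HolomorphicBanach
import HarnessLib

/-!
# The conjugate complex structure of a complex manifold, as a recharting along an antilinear automorphism

Layer `Literature/NumberTheory/Transcendental` (companion of `ComplexForms`, `ComplexFormsPullback` and of
`Geometry/Manifold/ModelChange`; cell hodgecm-mathlib, floor 0, kernel K-A1 of the named fact
`HodgeTheory.ConjEmbedding.isOfHodgeType_conj_iff`; sequel: `ConjugateRechartHodgeTypes`).  Printed content: C. Voisin, *Hodge Theory and
Complex Algebraic Geometry I* (2002), §6.1.2 (the conjugate complex structure `-J` of a complex manifold `X`, i.e. the complex manifold `X̄`,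
whose holomorphic functions are the conjugates of those of `X`), and P. Deligne, *Hodge cycles on abelian varieties* (1982), §1 p. 7 («as `ι`
defines a homeomorphism `σX^{an} → ισX^{an}` …»: the antiholomorphic identification of a complex manifold with its conjugate).

## The construction (no new definition)

For a complex manifold `M` charted on the complex normed space `E` (holomorphic atlas `[IsManifold 𝓘(ℂ, E) ω M]`) and a continuous
REAL-linear automorphism `L : E ≃L[ℝ] E` which is ANTILINEAR (`L (c • v) = c̄ • L v`; one exists on every finite-dimensional `E`,
`exists_antilinear`: coordinatewise conjugation in a basis), the tree's recharted manifold `Literature.Geometry.Manifold.Rechart L.toHomeomorph M`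
(`ModelChange.lean`: the same points and topology, every chart followed by `L`) IS the conjugate complex manifold `M̄`:

* `DifferentiableWithinAt.antilinear_conj` — `B ∘ h ∘ A` is complex-differentiable for `h` complex-differentiable and `A`, `B` continuous
  antilinear (its real derivative `B ∘ Dh ∘ A` is `ℂ`-linear);
* `symm_trans_trans_mem_contDiffGroupoid_of_antilinear`, `Rechart.isManifold_complex_of_antilinear` — the recharted atlas is again
  holomorphic: a transition map is `L ∘ g ∘ L⁻¹` with `g` holomorphic, complex-differentiable on an open set, hence analytic (the tree's
  `HolomorphicBanach.contDiffOn_omega`, [Chae1985] Thm 14.13);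
* `Rechart.isManifold_real_of_linear`, `Rechart.contMDiff_out_linear/into_linear` — its real `C^∞` structure is the recharted one and the
  identity maps `Rechart.out : M̄ → M`, `Rechart.into : M → M̄` are real `C^∞` (tree: `Rechart.isManifold`, `Rechart.contMDiff_out/into`),
  with differentials `L⁻¹`, `L` (`Rechart.mfderiv_out_linear/into_linear`: the case `H = E`, `I = 𝓘(ℝ, E)` of the tree's
  `Geometry/Manifold/RechartDifferential`, re-proved here because that file is not on the build farm) — they are ANTIholomorphic.

Everything is a theorem; no definition, no named fact, no `sorry`.  HC_CM (cell hodgecm-mathlib) is proved only modulo its printed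
citations until rung 0 closes; this file discharges none of them by itself.

## References
* [VoisinHodgeI2002] C. Voisin, *Hodge Theory and Complex Algebraic Geometry I*, CUP 2002, §2.3.1, §6.1.2.
* [Deligne1982HodgeCycles] P. Deligne, *Hodge cycles on abelian varieties*, LNM 900 (1982), §1 (p. 7).
* [Chae1985] S. B. Chae, *Holomorphy and Calculus in Normed Spaces* (1985), Thm 14.13.
* [Lee2013] J. M. Lee, *Introduction to Smooth Manifolds*, 2nd ed., Prop. 1.17, Prop. 3.6 (recharting; differentials in coordinates).
-/


noncomputable section

open scoped Manifold ContDiff Topology ComplexConjugate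
open Set Function Literature.Geometry.Manifold

namespace Literature.NumberTheory.Transcendental

/-! ## §0 Antilinear real automorphisms of a complex normed space -/

section Antilinear

variable {E : Type*} [NormedAddCommGroup E] [NormedSpace ℂ E]

/-- The inverse of an antilinear real automorphism is antilinear. [cite: VoisinHodgeI2002, §6.1.2] -/
theorem antilinear_symm (L : E ≃L[ℝ] E) (hL : ∀ (c : ℂ) (v : E), L (c • v) = conj c • L v) (c : ℂ) (w : E) :
    L.symm (c • w) = conj c • L.symm w := by
  apply L.injective
  rw [hL, L.apply_symm_apply, L.apply_symm_apply, Complex.conj_conj]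

/-- An antilinear map reverses the rotations `e^{iθ}`: `L (e^{iθ} • v) = e^{-iθ} • L v`. [cite: VoisinHodgeI2002, §2.3.1] -/
theorem antilinear_exp_smul (L : E ≃L[ℝ] E) (hL : ∀ (c : ℂ) (v : E), L (c • v) = conj c • L v) (θ : ℝ) (v : E) :
    L (Complex.exp (θ * Complex.I) • v) = Complex.exp ((-θ : ℝ) * Complex.I) • L v := by
  rw [hL, ← Complex.exp_conj, map_mul, Complex.conj_ofReal, Complex.conj_I]
  congr 2
  push_cast
  ring

/-- **Every finite-dimensional complex normed space has an antilinear continuous real automorphism** (coordinatewise complex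
conjugation in a basis; the real structure defining the conjugate complex structure, [VoisinHodgeI2002] §6.1.2). [cite: VoisinHodgeI2002, §6.1.2] -/
theorem exists_antilinear [FiniteDimensional ℂ E] :
    ∃ L : E ≃L[ℝ] E, ∀ (c : ℂ) (v : E), L (c • v) = conj c • L v := by
  let b := Module.finBasis ℂ E
  let e : E ≃ₗ[ℂ] (Fin (Module.finrank ℂ E) → ℂ) := b.equivFun
  let κ : E →ₗ[ℝ] E :=
    { toFun := fun v ↦ e.symm (star (e v))
      map_add' := fun v w ↦ by rw [map_add, star_add, map_add]
      map_smul' := fun r v ↦ by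
        rw [RingHom.id_apply, ← Complex.coe_smul, ← Complex.coe_smul, map_smul, star_smul, Complex.star_def,
          Complex.conj_ofReal, map_smul] }
  have hκ : Involutive κ := fun v ↦ by
    change e.symm (star (e (e.symm (star (e v))))) = v
    rw [e.apply_symm_apply, star_star, e.symm_apply_apply]
  have hκc : ∀ (c : ℂ) (v : E), κ (c • v) = conj c • κ v := fun c v ↦ by
    change e.symm (star (e (c • v))) = conj c • e.symm (star (e v))
    rw [map_smul, star_smul, Complex.star_def, map_smul]
  let Lₗ : E ≃ₗ[ℝ] E := LinearEquiv.ofInvolutive κ hκ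
  refine ⟨Lₗ.toContinuousLinearEquiv, fun c v ↦ ?_⟩
  exact hκc c v

end Antilinear

/-! ## §1 Complex differentiability is preserved under conjugation by antilinear maps -/

section Deriv

variable {E : Type*} [NormedAddCommGroup E] [NormedSpace ℂ E] {F : Type*} [NormedAddCommGroup F] [NormedSpace ℂ F]
  {E₁ : Type*} [NormedAddCommGroup E₁] [NormedSpace ℂ E₁] {F₁ : Type*} [NormedAddCommGroup F₁] [NormedSpace ℂ F₁]

/-- **`B ∘ h ∘ A` is complex-differentiable for `h` complex-differentiable and `A`, `B` continuous antilinear**: its real derivative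
`B ∘ Dh ∘ A` is `ℂ`-linear (two conjugations cancel).  This is why the conjugate `L ∘ g ∘ L⁻¹` of a holomorphic transition map by an
antilinear `L` is holomorphic, and why `conj ∘ g ∘ L⁻¹` is holomorphic for `g` holomorphic ([VoisinHodgeI2002] §6.1.2: the conjugate
complex structure). [cite: VoisinHodgeI2002, §6.1.2] -/
theorem DifferentiableWithinAt.antilinear_conj {h : E → F} {s : Set E} (A : E₁ →L[ℝ] E)
    (hA : ∀ (c : ℂ) (v : E₁), A (c • v) = conj c • A v) (B : F →L[ℝ] F₁) (hB : ∀ (c : ℂ) (w : F), B (c • w) = conj c • B w)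
    {x₁ : E₁} (hh : DifferentiableWithinAt ℂ h s (A x₁)) :
    DifferentiableWithinAt ℂ (B ∘ h ∘ A) (A ⁻¹' s) x₁ := by
  set h' : E →L[ℂ] F := fderivWithin ℂ h s (A x₁) with hh'
  have h2 : HasFDerivWithinAt h (h'.restrictScalars ℝ) s (A x₁) := hh.hasFDerivWithinAt.restrictScalars ℝ
  have h12 : HasFDerivWithinAt (h ∘ A) ((h'.restrictScalars ℝ).comp A) (A ⁻¹' s) x₁ :=
    h2.comp x₁ A.hasFDerivWithinAt (mapsTo_preimage _ _)
  have hreal : HasFDerivWithinAt (B ∘ h ∘ A) (B.comp ((h'.restrictScalars ℝ).comp A)) (A ⁻¹' s) x₁ :=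
    B.hasFDerivAt.comp_hasFDerivWithinAt x₁ h12
  let G : E₁ →L[ℂ] F₁ :=
    { toFun := fun v ↦ B (h' (A v))
      map_add' := fun v w ↦ by rw [map_add, map_add, map_add]
      map_smul' := fun c v ↦ by rw [hA, h'.map_smul, hB, Complex.conj_conj, RingHom.id_apply]
      cont := B.continuous.comp (h'.continuous.comp A.continuous) }
  have hG : G.restrictScalars ℝ = B.comp ((h'.restrictScalars ℝ).comp A) := by
    ext v
    rfl
  exact (hreal.of_restrictScalars ℝ hG).differentiableWithinAt

/-- Set form of `DifferentiableWithinAt.antilinear_conj` for a real automorphism `A = L⁻¹`: `B ∘ h ∘ L⁻¹` is complex-differentiable on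
`L⁻¹ ⁻¹' U` when `h` is on `U`. [cite: VoisinHodgeI2002, §6.1.2] -/
theorem DifferentiableOn.antilinear_conj {h : E → F} {U : Set E} (hh : DifferentiableOn ℂ h U) (L : E ≃L[ℝ] E)
    (hL : ∀ (c : ℂ) (v : E), L (c • v) = conj c • L v) (B : F →L[ℝ] F₁) (hB : ∀ (c : ℂ) (w : F), B (c • w) = conj c • B w) :
    DifferentiableOn ℂ (B ∘ h ∘ L.symm) ((L.symm : E → E) ⁻¹' U) := fun _ hy ↦
  DifferentiableWithinAt.antilinear_conj (L.symm : E →L[ℝ] E) (antilinear_symm L hL) B hB (hh _ hy)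

end Deriv

/-! ## §2 The recharted atlas along an antilinear automorphism is holomorphic -/

section Atlas

variable {E : Type*} [NormedAddCommGroup E] [NormedSpace ℂ E] {M : Type*} [TopologicalSpace M] [ChartedSpace E M]

/-- **Conjugating the holomorphic groupoid by an antilinear automorphism.** For `e` in the analytic groupoid of `E` and `L : E ≃L[ℝ] E`
antilinear, `L⁻¹ ≫ e ≫ L` (the map `L ∘ e ∘ L⁻¹`) is again in the analytic groupoid: it is complex-differentiable
(`DifferentiableOn.antilinear_conj`) on an open set, hence analytic ([Chae1985] Thm 14.13, the tree's `HolomorphicBanach.contDiffOn_omega`).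
[cite: VoisinHodgeI2002, §6.1.2] -/
theorem symm_trans_trans_mem_contDiffGroupoid_of_antilinear [CompleteSpace E] (L : E ≃L[ℝ] E)
    (hL : ∀ (c : ℂ) (v : E), L (c • v) = conj c • L v) {e : OpenPartialHomeomorph E E}
    (he : e ∈ contDiffGroupoid ω 𝓘(ℂ, E)) :
    L.toHomeomorph.toOpenPartialHomeomorph.symm ≫ₕ e ≫ₕ L.toHomeomorph.toOpenPartialHomeomorph ∈ contDiffGroupoid ω 𝓘(ℂ, E) := by
  rw [Literature.Topology.FourManifolds.mem_contDiffGroupoid_iff_contMDiffOn] at he ⊢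
  simp only [contMDiffOn_iff_contDiffOn] at he ⊢
  obtain ⟨he, he'⟩ := he
  have hd : DifferentiableOn ℂ e e.source := he.differentiableOn (by simp)
  have hd' : DifferentiableOn ℂ e.symm e.target := he'.differentiableOn (by simp)
  have hLL : ∀ (c : ℂ) (v : E), (L : E →L[ℝ] E) (c • v) = conj c • (L : E →L[ℝ] E) v := hL
  constructor
  · have hs : (L.toHomeomorph.toOpenPartialHomeomorph.symm ≫ₕ e ≫ₕ L.toHomeomorph.toOpenPartialHomeomorph).source =
        (L.symm : E → E) ⁻¹' e.source := by
      ext y; simp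
    have hf : ⇑(L.toHomeomorph.toOpenPartialHomeomorph.symm ≫ₕ e ≫ₕ L.toHomeomorph.toOpenPartialHomeomorph) =
        (L : E →L[ℝ] E) ∘ e ∘ L.symm := rfl
    rw [hs, hf]
    exact Literature.Analysis.Complex.HolomorphicBanach.contDiffOn_omega (DifferentiableOn.antilinear_conj hd L hL _ hLL)
      (e.open_source.preimage L.symm.continuous)
  · have hs : (L.toHomeomorph.toOpenPartialHomeomorph.symm ≫ₕ e ≫ₕ L.toHomeomorph.toOpenPartialHomeomorph).target =
        (L.symm : E → E) ⁻¹' e.target := by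
      ext y; simp
    have hf : ⇑(L.toHomeomorph.toOpenPartialHomeomorph.symm ≫ₕ e ≫ₕ L.toHomeomorph.toOpenPartialHomeomorph).symm =
        (L : E →L[ℝ] E) ∘ e.symm ∘ L.symm := rfl
    rw [hs, hf]
    exact Literature.Analysis.Complex.HolomorphicBanach.contDiffOn_omega (DifferentiableOn.antilinear_conj hd' L hL _ hLL)
      (e.open_target.preimage L.symm.continuous)

/-- **The conjugate complex manifold.** Recharting a complex manifold `M` (holomorphic atlas on `E`) along an antilinear real
automorphism `L` of `E` gives a holomorphic atlas again: `Rechart L.toHomeomorph M` is a complex manifold — the conjugate complex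
manifold `M̄` ([VoisinHodgeI2002] §6.1.2; [Deligne1982HodgeCycles] §1: `σX^{an}` for `σ` = complex conjugation).  Not an instance
(hypothesis `hL`); install with `haveI`. [cite: VoisinHodgeI2002, §6.1.2] -/
theorem Rechart.isManifold_complex_of_antilinear [CompleteSpace E] [IsManifold 𝓘(ℂ, E) ω M] (L : E ≃L[ℝ] E)
    (hL : ∀ (c : ℂ) (v : E), L (c • v) = conj c • L v) :
    IsManifold 𝓘(ℂ, E) ω (Rechart L.toHomeomorph M) := by
  haveI : HasGroupoid (Rechart L.toHomeomorph M) (contDiffGroupoid ω 𝓘(ℂ, E)) :=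
    { compatible := by
        rintro _ _ ⟨c, hc, rfl⟩ ⟨c', hc', rfl⟩
        rw [Rechart.chart_symm_trans_chart]
        exact symm_trans_trans_mem_contDiffGroupoid_of_antilinear L hL (HasGroupoid.compatible hc hc') }
  exact IsManifold.mk' _ _ _

/-- The real `C^∞` structure of the recharted manifold along a continuous real-linear automorphism (the tree's
`Rechart.isManifold` fed with `Rechart.contMDiff_of_apply_eq_linear`; [Lee2013] Prop. 1.17). Not an instance; install with `haveI`.
[cite: Lee2013, Prop. 1.17] -/
theorem Rechart.isManifold_real_of_linear [IsManifold 𝓘(ℝ, E) ∞ M] (L : E ≃L[ℝ] E) :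
    IsManifold 𝓘(ℝ, E) ∞ (Rechart L.toHomeomorph M) :=
  Rechart.isManifold L.toHomeomorph M
    (Rechart.contMDiff_of_apply_eq_linear (I := 𝓘(ℝ, E)) L.toHomeomorph L fun _ ↦ rfl)
    (Rechart.contMDiff_symm_of_apply_eq_linear (I := 𝓘(ℝ, E)) L.toHomeomorph L fun _ ↦ rfl)

/-- The identity `out : M̄ → M` is real `C^∞` ([Lee2013] Prop. 1.17; tree `Rechart.contMDiff_out`). [cite: Lee2013, Prop. 1.17] -/
theorem Rechart.contMDiff_out_linear [IsManifold 𝓘(ℝ, E) ∞ M] (L : E ≃L[ℝ] E) :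
    ContMDiff 𝓘(ℝ, E) 𝓘(ℝ, E) ∞ (Rechart.out L.toHomeomorph M) :=
  Rechart.contMDiff_out L.toHomeomorph M
    (Rechart.contMDiff_of_apply_eq_linear (I := 𝓘(ℝ, E)) L.toHomeomorph L fun _ ↦ rfl)
    (Rechart.contMDiff_symm_of_apply_eq_linear (I := 𝓘(ℝ, E)) L.toHomeomorph L fun _ ↦ rfl)

/-- The identity `into : M → M̄` is real `C^∞` ([Lee2013] Prop. 1.17; tree `Rechart.contMDiff_into`). [cite: Lee2013, Prop. 1.17] -/
theorem Rechart.contMDiff_into_linear [IsManifold 𝓘(ℝ, E) ∞ M] (L : E ≃L[ℝ] E) :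
    ContMDiff 𝓘(ℝ, E) 𝓘(ℝ, E) ∞ (Rechart.into L.toHomeomorph M) :=
  Rechart.contMDiff_into L.toHomeomorph M
    (Rechart.contMDiff_of_apply_eq_linear (I := 𝓘(ℝ, E)) L.toHomeomorph L fun _ ↦ rfl)
    (Rechart.contMDiff_symm_of_apply_eq_linear (I := 𝓘(ℝ, E)) L.toHomeomorph L fun _ ↦ rfl)

/-! ## §3 The differentials of the identity maps `out`, `into` (adapted from `Geometry/Manifold/RechartDifferential`) -/

/-- The extended chart of `Rechart L.toHomeomorph M` at `p` as a map: `L ∘ c ∘ out`, `c` the chart of `M` at `out p`. [cite: Lee2013, Prop. 1.17] -/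
theorem Rechart.extChartAt_coe_linear {𝕜 : Type*} [NontriviallyNormedField 𝕜] [NormedSpace 𝕜 E] (L : E ≃L[ℝ] E)
    (p : Rechart L.toHomeomorph M) :
    ⇑(extChartAt 𝓘(𝕜, E) p) = L ∘ chartAt E (Rechart.out L.toHomeomorph M p) ∘ Rechart.out L.toHomeomorph M := by
  ext y
  simp [extChartAt, Rechart.chartAt_def]

/-- The inverse extended chart of `Rechart L.toHomeomorph M` at `p` as a map: `into ∘ c.symm ∘ L.symm`. [cite: Lee2013, Prop. 1.17] -/
theorem Rechart.extChartAt_symm_coe_linear {𝕜 : Type*} [NontriviallyNormedField 𝕜] [NormedSpace 𝕜 E] (L : E ≃L[ℝ] E)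
    (p : Rechart L.toHomeomorph M) :
    ⇑(extChartAt 𝓘(𝕜, E) p).symm =
      Rechart.into L.toHomeomorph M ∘ (chartAt E (Rechart.out L.toHomeomorph M p)).symm ∘ L.symm := by
  ext y
  simp [extChartAt, Rechart.chartAt_def]

/-- **`d(into)_x = L`**: the identity `M → M̄` has differential `L` in the charts `c` and `L ∘ c` ([Lee2013] Prop. 3.6;
the tree's `Rechart.hasMFDerivAt_into`, case `I = 𝓘(ℝ, E)`). [cite: Lee2013, Prop. 1.17] -/
theorem Rechart.hasMFDerivAt_into_linear (L : E ≃L[ℝ] E) (x : M) :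
    HasMFDerivAt 𝓘(ℝ, E) 𝓘(ℝ, E) (Rechart.into L.toHomeomorph M) x (L : E →L[ℝ] E) := by
  refine ⟨(Rechart.continuous_into _ M).continuousAt, ?_⟩
  simp only [writtenInExtChartAt, modelWithCornersSelf_coe, range_id, hasFDerivWithinAt_univ]
  have ht : (extChartAt 𝓘(ℝ, E) x).target ∈ 𝓝 (extChartAt 𝓘(ℝ, E) x x) := extChartAt_target_mem_nhds x
  refine (L : E →L[ℝ] E).hasFDerivAt.congr_of_eventuallyEq ?_
  filter_upwards [ht] with u hu
  have hu' : u ∈ (chartAt E x).target := by simpa [extChartAt] using hu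
  rw [comp_apply, comp_apply, Rechart.extChartAt_coe_linear, comp_apply, comp_apply, extChartAt_coe_symm, comp_apply,
    modelWithCornersSelf_coe_symm, id_eq]
  change L (chartAt E x ((chartAt E x).symm u)) = L u
  rw [(chartAt E x).right_inv hu']

/-- `mfderiv` of the identity `into : M → M̄` is `L`. [cite: Lee2013, Prop. 1.17] -/
theorem Rechart.mfderiv_into_linear (L : E ≃L[ℝ] E) (x : M) :
    mfderiv 𝓘(ℝ, E) 𝓘(ℝ, E) (Rechart.into L.toHomeomorph M) x = (L : E →L[ℝ] E) :=
  (Rechart.hasMFDerivAt_into_linear L x).mfderiv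

/-- **`d(out)_p = L⁻¹`**: the identity `M̄ → M` has differential `L.symm` in the charts `L ∘ c` and `c` ([Lee2013] Prop. 3.6;
the tree's `Rechart.hasMFDerivAt_out`, case `I = 𝓘(ℝ, E)`). [cite: Lee2013, Prop. 1.17] -/
theorem Rechart.hasMFDerivAt_out_linear (L : E ≃L[ℝ] E) (p : Rechart L.toHomeomorph M) :
    HasMFDerivAt 𝓘(ℝ, E) 𝓘(ℝ, E) (Rechart.out L.toHomeomorph M) p (L.symm : E →L[ℝ] E) := by
  refine ⟨(Rechart.continuous_out _ M).continuousAt, ?_⟩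
  simp only [writtenInExtChartAt, modelWithCornersSelf_coe, range_id, hasFDerivWithinAt_univ]
  have ht : (extChartAt 𝓘(ℝ, E) p).target ∈ 𝓝 (extChartAt 𝓘(ℝ, E) p p) := extChartAt_target_mem_nhds p
  refine (L.symm : E →L[ℝ] E).hasFDerivAt.congr_of_eventuallyEq ?_
  filter_upwards [ht] with u hu
  have hu' : L.symm u ∈ (chartAt E (Rechart.out L.toHomeomorph M p)).target := by
    simpa [extChartAt, Rechart.chartAt_def] using hu
  rw [comp_apply, comp_apply, Rechart.extChartAt_symm_coe_linear, comp_apply, comp_apply, extChartAt_coe, comp_apply,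
    modelWithCornersSelf_coe, id_eq]
  change chartAt E (Rechart.out L.toHomeomorph M p) ((chartAt E (Rechart.out L.toHomeomorph M p)).symm (L.symm u)) = L.symm u
  rw [(chartAt E _).right_inv hu']

/-- `mfderiv` of the identity `out : M̄ → M` is `L⁻¹`. [cite: Lee2013, Prop. 1.17] -/
theorem Rechart.mfderiv_out_linear (L : E ≃L[ℝ] E) (p : Rechart L.toHomeomorph M) :
    mfderiv 𝓘(ℝ, E) 𝓘(ℝ, E) (Rechart.out L.toHomeomorph M) p = (L.symm : E →L[ℝ] E) :=
  (Rechart.hasMFDerivAt_out_linear L p).mfderiv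

end Atlas

end Literature.NumberTheory.Transcendental

end
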